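import Literature.MathematicalPhysics.QuantumFieldTheory.Balaban1983to89.B8Prop6DentedCubeMemberScalarGammaOfReal1
import Literature.MathematicalPhysics.QuantumFieldTheory.Balaban1983to89.B8Eq1101DentedCubeMemberRealPrinted

/-!
# `Balaban1983to89.B8Prop6DentedCubeMemberScalarGammaHolds` — [Balaban1985RegularSpaces] PROPOSITION 6 (p. 99) AS `Node00.GaugedBoundB8D` AT EVERY DENTED CUBE MEMBER OF
# [Balaban1985Variational] (148)–(150), ODD `L ≥ 5`, `d ≥ 2` — UNCONDITIONAL: the (β) road's crown with ALL FOUR named inputs ([4] Thms 3.1 ×2, 3.2, 3.3 on `{Ω′_j}`) DISCHARGED —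
# the dented twin of dag-n05-c's `B8Prop6CubeMemberScalarGammaHolds.gaugedBoundB8_cubeMember_scalar_γ_holds`

statement-level skeleton of published theorems with citation tags; proofs where landed; nothing here is a claim about the Yang–Mills mass gap

`[Balaban1985RegularSpaces]` ("B8" = [6], CMP **99** (1985) 75–102) Prop. 6 (1.135)–(1.138) p. 99, p. 98, (1.59) p. 86, (1.62) p. 87, (1.91)–(1.92) p. 91, (1.98) p. 92, (1.101)
p. 93; `[Balaban1985Variational]` ("[15]", CMP **102** (1985) 277–309) (148)–(152) p. 301, p. 300; `[Balaban1985BackgroundPropagators]` ([4], CMP **99** (1985) 389–434) Thms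
3.1–3.3 pp. 398–399; `[Balaban1984PropagatorsII]` ("B6", CMP **96** (1984) 223–250) Props. 2.3, 2.6.  PDFs held (`paper:balaban1985-cmp99-…`, `…-cmp102-…`).

CITATION HEADER (lean-in-tree rule).  Cell `pub-ymgap` (D-0062), node N05 = [B8], seat `pub-ymgap-dag-n05-e` (g32; row s3b, the Prop-6 lane; (β) road = Proposition 6 at the
DENTED cube members of NODE 00's carrier `CubeB8D`; INTENT I.43617).  WHY THIS FILE.  g31 crowned the (β) road MODULO four named facts on [15]'s dented sequence `{Ω′_j}`; g32
proved all four: `ineq159FlatDentedCubeMemberPrinted_holds` (p673833; torus transplant), `gBoundDentedCubeMemberPrinted_of_one_le` (p673999; box transfer of [4] Thm 3.2),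
`real1DentedCubeMemberPrinted_of_one_le` ∕ `real1M4DentedCubeMemberPrinted_of_one_le` (this unit's file 8; the dented parametrix).  THIS FILE composes them by name with the
crown `gaugedBoundB8D_dentedMember_scalar_γ_of_real1Dented` (p674270): [6] Proposition 6's conclusion as NODE 00's `GaugedBoundB8D` at EVERY dented member of print's sub-lattice,
odd `L ≥ 5`, `d ≥ 2`, with NO named hypothesis left — what [15] p. 300–301 uses for «a cube □ intersecting Ω_k but not Ω_{k+1}».

WHAT THIS FILE PROVES (kernel-checked; one composition by name).  ★★★ `gaugedBoundB8D_dentedMember_scalar_γ_holds (hd2 : 2 ≤ d) (hL5 : 5 ≤ L) (hodd : Odd L)` — conclusion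
verbatim the crown's: `∃ B₀ c₁ ρ₀ M₀ N₀ R₀, 1 ≤ B₀ ∧ 0 < c₁ ∧ ∀ η > 0, ∀ c : CubeB8D d L K Ω` on print's p. 98 sub-lattice (`M_h = Lˢ` side conditions above threshold) with the
anchored dent premise ([6] (1.4)₂ on `□_k`'s grid), `∀` unitary `U₀ ∈ 𝔄_K(α₀)` with `7dL²Mα₀ ≤ c₁`: `GaugedBoundB8D L η U₀ c (7dL²·5dLB₀·c.M·α₀)`.
HONEST SCOPE ∕ NOT CLAIMED.  Composition by name of theorems of record; every analytic input is a hypothesis-free lit-balaban reading (r03∕r05∕p21∕p38) transferred to the dented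
member by token twins of dag-n05-c's pure transfers; NO new estimate; nothing of [4]∕[6]∕[15] asserted beyond those theorems; count-neutral; N05 ∕ N07 NOT discharged (this is the
Prop-6 INPUT of [15]'s inductive step at the dented members, not a node knit); one finite `T⁴` programme at fixed `ε`, Bałaban as printed; nothing continuum ∕ ℝ⁴ ∕ OS ∕ mass-gap
∕ Clay.  No `sorry`, no `def`, no `instance`, no `notation`.  Unit `pub-ymgap-dag-n05-e` (g32), 2026-08-28.

RELATED IN THE TREE, NOT DUPLICATED (`rg -l 'DentedCubeMemberScalarGammaHolds' Balaban1983to89` = 0, 2026-08-28T23:15Z): `B8Prop6DentedCubeMemberScalarGammaOfReal1` (g32; the crown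
modulo REAL-1, USED), `B8Eq1101DentedCubeMemberRealPrinted` (g32; the last two facts), the pure unconditional crown `B8Prop6CubeMemberScalarGammaHolds` (dag-n05-c; the model).
-/

noncomputable section

namespace Literature.MathematicalPhysics.QuantumFieldTheory.Balaban1983to89.B8Prop6DentedCubeMemberScalarGammaHolds

open scoped Matrix
open B7Prop1Explicit B7Prop2Explicit B7Prop1Local
open B8Ineq132 (InAk)
open B8Eq1101DentedCubeMemberRealPrinted (real1DentedCubeMemberPrinted_of_one_le real1M4DentedCubeMemberPrinted_of_one_le)
open B8Prop6DentedCubeMemberScalarGammaOfReal1 (gaugedBoundB8D_dentedMember_scalar_γ_of_real1Dented)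
open Node00 (CubeB8D GaugedBoundB8D)
open Literature.MathematicalPhysics.QuantumLattice (blockMap)

export B7Prop1Explicit (Site)

variable {d : ℕ} {𝔸 : Type} [CStarAlgebra 𝔸] [Nontrivial 𝔸]

open Classical in
/-- ★★★ **PROPOSITION 6 (p. 99) AS `Node00.GaugedBoundB8D` AT EVERY DENTED CUBE MEMBER OF PRINT's BIG-BLOCK SUB-LATTICE, FOR ODD `L ≥ 5` AND `d ≥ 2` — UNCONDITIONALLY**:
the (β) crown `gaugedBoundB8D_dentedMember_scalar_γ_of_real1Dented` with its two REAL-1 hypotheses DISCHARGED by this unit's dented parametrix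
(`real1DentedCubeMemberPrinted_of_one_le`, `real1M4DentedCubeMemberPrinted_of_one_le`).  The dented twin of dag-n05-c's `gaugedBoundB8_cubeMember_scalar_γ_holds`: [6] Prop. 6's
conclusion on [15]'s dented sequence `{Ω′_j}` ((148)–(152)) with every analytic input ([4] Thms 3.1 ×2, 3.2, 3.3 there) a theorem of record.
[cite: Balaban1985RegularSpaces, Prop. 6 (1.135)–(1.138) p.99, p.98, (1.59) p.86, (1.91)–(1.92) p.91, (1.98) p.92, (1.101) p.93; Balaban1985Variational, (148)–(152) p.301, p.300; Balaban1985BackgroundPropagators, Thms 3.1–3.3 pp.398–399; Balaban1984PropagatorsII, Prop. 2.6 (2.136) p.247, Prop. 2.3 (2.87) p.238, Prop. 2.2 (2.67) p.234] -/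
theorem gaugedBoundB8D_dentedMember_scalar_γ_holds (hd2 : 2 ≤ d) {L : ℕ} (hL5 : 5 ≤ L) (hodd : Odd L) :
    ∃ B₀ c₁ ρ₀ M₀ : ℝ, ∃ N₀ R₀ : ℕ, 1 ≤ B₀ ∧ 0 < c₁ ∧ ∀ (η : ℝ), 0 < η → ∀ {K : ℕ} {Ω : ℕ → Set (Site d)} (c : CubeB8D d L K Ω),
      -- PRINT'S SIDE CONDITIONS (p. 98) on the cube datum in the named facts' letters (`M_h = Lˢ`), above threshold
      ∀ (s R : ℕ), 3 ≤ L ^ s → M₀ ≤ (L : ℝ) ^ (s + 1) → L ^ (s + 1) ∣ c.ρ → L ^ (s + 1) ∣ c.M → R * L ^ (s + 1) ≤ c.ρ → 2 * L ≤ R →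
        R₀ ≤ R → N₀ + 1 ≤ R * L ^ (s + 1) → ρ₀ ≤ (c.ρ : ℝ) →
      -- THE DENT PREMISE ([6] (1.4)₂): `Ω_k` is a union of cubes of side `L^{s+1}Lᵏ` of the grid anchored at `□_k`'s fine lower corner `Lᵏ(c.a − c.ρ)`
      (∀ x y : Site d,
          blockMap (L ^ (s + 1) * L ^ c.k) (x - fun i => (L : ℤ) ^ c.k * (c.a i - c.ρ)) =
            blockMap (L ^ (s + 1) * L ^ c.k) (y - fun i => (L : ℤ) ^ c.k * (c.a i - c.ρ)) → x ∈ Ω c.k → y ∈ Ω c.k) →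
      ∀ (U₀ : Site d → Fin d → 𝔸ˣ), (∀ x κ, U₀ x κ ∈ unitaryUnits 𝔸) → ∀ (α₀ : ℝ), 0 < α₀ → InAk L K η α₀ Ω U₀ →
      7 * d * (L : ℝ) ^ 2 * c.M * α₀ ≤ c₁ →
      GaugedBoundB8D L η U₀ c (7 * d * (L : ℝ) ^ 2 * (5 * (d : ℝ) * L * B₀) * c.M * α₀) := by
  obtain ⟨d', rfl⟩ : ∃ d', d = d' + 1 := ⟨d - 1, by omega⟩
  obtain ⟨ℓ, rfl⟩ : ∃ ℓ, L = ℓ + 1 := ⟨L - 1, by omega⟩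
  have hℓ : 1 ≤ ℓ := by omega
  have hR1 : B8Real1DentedCubeMember.Real1DentedCubeMemberPrinted (d' + 1 - 1) (ℓ + 1 - 1) := by
    rw [Nat.add_sub_cancel, Nat.add_sub_cancel]; exact real1DentedCubeMemberPrinted_of_one_le d' ℓ hℓ
  have hR1' : B8Real1DentedCubeMember.Real1M4DentedCubeMemberPrinted (d' + 1 - 1) (ℓ + 1 - 1) := by
    rw [Nat.add_sub_cancel, Nat.add_sub_cancel]; exact real1M4DentedCubeMemberPrinted_of_one_le d' ℓ hℓ
  exact gaugedBoundB8D_dentedMember_scalar_γ_of_real1Dented (𝔸 := 𝔸) hd2 hL5 hodd hR1 hR1'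

#print axioms gaugedBoundB8D_dentedMember_scalar_γ_holds

end Literature.MathematicalPhysics.QuantumFieldTheory.Balaban1983to89.B8Prop6DentedCubeMemberScalarGammaHolds

end
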